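import Summits.MatrixMultiplication.OmegaCensus.SmallFormats.MatMul22nLoadedPlaneRankOne
import Summits.MatrixMultiplication.OmegaCensus.SmallFormats.MatMul22nGF3TypeFRung
import HarnessLib

/-!
# ω-census family (a): the loaded-plane law in CENSUS COORDINATES (`𝔽₃`, length `3n + 3`, `n ≥ 8`)

Cell `pub-omega` (unit `pub-omega-tensor`, gen 39), topic `Summits/MatrixMultiplication/OmegaCensus` (sub-folder
`SmallFormats`). Framing (verbatim): lottery ticket; floor = certified bounds/negative ranges. HONEST FRAMING: bookkeeping — the
any-field structural theorem of tensor g38 (`RankOneCensus.two_mul_add_card_le_of_loaded_row/_col`, p721168: a rank-one ROW or COLUMN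
plane carrying `≥ 3` X-forms of a length-`(3n+3)` computation of `⟨2,2,n⟩` forces `2n + load ≤ #{i : det U_i = 0} + 8`) restated on the
count vector `cnt (xMarginal β)` over tensor g31's 40 classes, so that it can enter the `cnt_clauses` pipeline as a clause. This is item 1c
of tensor g38's HANDOFF («put the pattern constraints into census coordinates»); it is the clause behind the kernel filter of GO #159
(tensor g38, kit j331999) and of tensor g39's exact landscape re-derivation. Nothing here is a bound on any rank; nothing on `ω`.

* `Enum723.card_filter_det_eq_zero` — for a nowhere-zero marginal `m`, `#{i : det (m i) = 0} = ∑_{a ∈ [24, 40)} cnt m a` (the rank-one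
  classes are exactly the classes `24–39`; table fact by `decide` over the `81` flat matrices).
* `Enum723.loaded_row_clause` / `loaded_col_clause` — for `β` a length-`(3n+3)` computation of `⟨2,2,n⟩` over `𝔽₃`, `n ≥ 8`, with nowhere-zero
  X-marginal and `c = cnt (xMarginal β)`: for every row clause `k ∈ [32, 36)` (resp. column clause `k ∈ [36, 40)`) with `3 ≤ load c k`,
  `2n + load c k ≤ (∑_{a ∈ [24,40)} c a) + 8`.
* `Enum723.loaded_plane_clause` — both at once (`k ∈ [32, 40)`).
-/

namespace Summit.MatrixMultiplication.OmegaCensus.SmallFormats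

open Finset Matrix
open Literature.Computability.AlgebraicComplexity
open Summit.MatrixMultiplication.OmegaCensus.RankOnePlaneCapGeneral

namespace Enum723

/-- Table fact: a nonzero flat matrix is singular iff its class is one of the rank-one classes `24–39`. -/
theorem det03_iff_le_classOf : ∀ A : F4, isZero43 A = false → (det03 A = true ↔ 24 ≤ classOf A) :=
  forall_of_forall_mk4 (by decide)

/-- `det = 0` on matrices is the flat test `det03`. -/
theorem det_eq_zero_iff_det03 (U : Matrix (Fin 2) (Fin 2) (ZMod 3)) : U.det = 0 ↔ det03 (mflat U) = true := by
  rw [Matrix.det_fin_two, det03, decide_eq_true_eq, mflat_apply, mflat_apply, mflat_apply, mflat_apply]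
  constructor
  · intro h; exact (sub_eq_zero.mp h)
  · intro h; exact sub_eq_zero.mpr h

section Counting

variable {r : ℕ} (m : Fin r → Matrix (Fin 2) (Fin 2) (ZMod 3)) (hm : ∀ i, m i ≠ 0)
include hm

/-- **The number of singular terms is the total count of the rank-one classes `24–39`.** -/
theorem card_filter_det_eq_zero :
    (Finset.univ.filter fun i => (m i).det = 0).card = ∑ a ∈ Finset.Ico 24 40, cnt m a := by
  classical
  have hfib := Finset.card_eq_sum_card_fiberwise (s := Finset.univ.filter fun i => (m i).det = 0)
    (f := fun i => classOf (mflat (m i))) (t := Finset.Ico 24 40) (fun i hi => by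
      have hi' := Finset.mem_filter.mp (Finset.mem_coe.mp hi)
      have h0 := isZero43_mflat (hm i)
      exact Finset.mem_coe.mpr (Finset.mem_Ico.mpr
        ⟨(det03_iff_le_classOf _ h0).mp ((det_eq_zero_iff_det03 _).mp hi'.2), (classOf_spec _ h0).1⟩))
  rw [hfib]
  refine Finset.sum_congr rfl fun a ha => ?_
  have ha' := Finset.mem_Ico.mp ha
  rw [cnt, ← filter_classOf_eq m hm a ha'.2, Finset.filter_filter]
  congr 1; ext i
  simp only [Finset.mem_filter, Finset.mem_univ, true_and]
  constructor
  · exact fun h => h.2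
  · intro h
    have h0 := isZero43_mflat (hm i)
    refine ⟨(det_eq_zero_iff_det03 _).mpr ((det03_iff_le_classOf _ h0).mpr ?_), h⟩
    rw [h]; exact ha'.1

end Counting

/-- **Loaded ROW plane clause in census coordinates** (`𝔽₃`, length `3n+3`, `n ≥ 8`): a row clause `k ∈ [32,36)` with load `≥ 3` forces
`2n + load ≤ (#rank-one terms) + 8`. -/
theorem loaded_row_clause {n : ℕ} (hn : 8 ≤ n) (β : BilinComp (mulBilin (ZMod 3) 2 2 n) (Fin (3 * n + 3)))
    (hm : ∀ i, xMarginal β i ≠ 0) (k : ℕ) (hk1 : 32 ≤ k) (hk2 : k < 36) (h3 : 3 ≤ load (cnt (xMarginal β)) k) :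
    2 * n + load (cnt (xMarginal β)) k ≤ (∑ a ∈ Finset.Ico 24 40, cnt (xMarginal β) a) + 8 := by
  classical
  have hload := card_filter_csem (xMarginal β) hm k (by omega)
  have h1 : ¬ k < 32 := by omega
  have e : (Finset.univ.filter fun i => csem k (mflat (xMarginal β i))) =
      Finset.univ.filter fun i => Matrix.vecMul (lamF (k - 32)) (xMarginal β i) = 0 := by
    congr 1; ext i; simp only [csem, if_neg h1, if_pos hk2, vecMul_eq_zero_iff, mflat_apply]
  rw [e] at hload
  have h3' : 3 ≤ (Finset.univ.filter fun i => Matrix.vecMul (lamF (k - 32)) (xMarginal β i) = 0).card := by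
    rw [hload]; exact h3
  have h := RankOneCensus.two_mul_add_card_le_of_loaded_row hn β (Fintype.card_fin _) (lamF (k - 32))
    (lamF_ne _ (by omega)) _ h3' fun i hi => (Finset.mem_filter.mp hi).2
  rw [hload] at h
  have hc := card_filter_det_eq_zero (xMarginal β) hm
  refine le_trans h ?_
  rw [← hc]
  refine le_of_eq ?_
  congr 2
  ext i; simp only [Finset.mem_filter, Finset.mem_univ, true_and]

/-- **Loaded COLUMN plane clause in census coordinates** (`𝔽₃`, length `3n+3`, `n ≥ 8`): a column clause `k ∈ [36,40)` with load `≥ 3`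
forces `2n + load ≤ (#rank-one terms) + 8`. -/
theorem loaded_col_clause {n : ℕ} (hn : 8 ≤ n) (β : BilinComp (mulBilin (ZMod 3) 2 2 n) (Fin (3 * n + 3)))
    (hm : ∀ i, xMarginal β i ≠ 0) (k : ℕ) (hk1 : 36 ≤ k) (hk2 : k < 40) (h3 : 3 ≤ load (cnt (xMarginal β)) k) :
    2 * n + load (cnt (xMarginal β)) k ≤ (∑ a ∈ Finset.Ico 24 40, cnt (xMarginal β) a) + 8 := by
  classical
  have hload := card_filter_csem (xMarginal β) hm k (by omega)
  have h1 : ¬ k < 32 := by omega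
  have h2 : ¬ k < 36 := by omega
  have e : (Finset.univ.filter fun i => csem k (mflat (xMarginal β i))) =
      Finset.univ.filter fun i => Matrix.mulVec (xMarginal β i) (lamF (k - 36)) = 0 := by
    congr 1; ext i; simp only [csem, if_neg h1, if_neg h2, if_pos hk2, mulVec_eq_zero_iff, mflat_apply]
  rw [e] at hload
  have h3' : 3 ≤ (Finset.univ.filter fun i => Matrix.mulVec (xMarginal β i) (lamF (k - 36)) = 0).card := by
    rw [hload]; exact h3
  have h := RankOneCensus.two_mul_add_card_le_of_loaded_col hn β (Fintype.card_fin _) (lamF (k - 36))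
    (lamF_ne _ (by omega)) _ h3' fun i hi => (Finset.mem_filter.mp hi).2
  rw [hload] at h
  have hc := card_filter_det_eq_zero (xMarginal β) hm
  refine le_trans h ?_
  rw [← hc]
  refine le_of_eq ?_
  congr 2
  ext i; simp only [Finset.mem_filter, Finset.mem_univ, true_and]

/-- **Loaded plane clause** (rows and columns, `k ∈ [32, 40)`). -/
theorem loaded_plane_clause {n : ℕ} (hn : 8 ≤ n) (β : BilinComp (mulBilin (ZMod 3) 2 2 n) (Fin (3 * n + 3)))
    (hm : ∀ i, xMarginal β i ≠ 0) (k : ℕ) (hk1 : 32 ≤ k) (hk2 : k < 40) (h3 : 3 ≤ load (cnt (xMarginal β)) k) :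
    2 * n + load (cnt (xMarginal β)) k ≤ (∑ a ∈ Finset.Ico 24 40, cnt (xMarginal β) a) + 8 := by
  by_cases h : k < 36
  · exact loaded_row_clause hn β hm k hk1 h h3
  · exact loaded_col_clause hn β hm k (by omega) hk2 h3

end Enum723

end Summit.MatrixMultiplication.OmegaCensus.SmallFormats
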